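import Summits.AtomisticToContinuum.Crystallization.Theorems.OverbindingBudgetCleanlessCut

/-!
# OverbindingBudget — graded bareness, the GRADED cleanless-excess law, the margin-uniform Barlow literal (depth cut, part 1/3; helper `--supports stmt-31280`)

decomp-a2c lens 4 «minimal counterexample / extremal reduction», generation 18, part 1 of 3 of the DEPTH CUT of the generation-17 declared residual
`CleanBearingResidual 10` (crux `RobustDefectLimitWindows`, stmt-AtomisticToContinuum-31280; registered line v7 «HostedDustCut», declared residual
`UnhostedResidual 10` = `stub_unhostedResidual`; generation 17 = landed `Theorems/OverbindingBudgetCleanlessCut.lean`).  Parts: 1 = this file (graded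
predicates, the graded law, kernels K-g1 … K-g7, pins); 2 = `OverbindingBudgetDeepBareExclusion` (the depth kernel `shallowBearing_of_graded`);
3 = `OverbindingBudgetCleanlessCutDepth` (the cut `CleanBearingResidual r₀ ⟺ DeepPiece r₀ ∧ ShallowResidual r₀`, the door side VACUOUS given the graded
law, compositions down to the registered residual, pins; the node narrative lives there).  Nothing in the three files is registered on the line (cell
critic waiver (w2), CRITIC-LEDGER rows 134 / 213 / 214): Theorems helpers over LANDED files only; no stub re-typed.

* §A  `BareOnT t₀ Y K` — GRADED bareness: no site of `Y ∩ K` is `t₀`-robustly clean Barlow (`CleanT a t₀`) at any admissible spacing `a ∈ [47/50, 1]`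
  (approximate bareness IS transported by ε-matchings, exact bareness `BareOn` is not); THE GRADED LAW `CleanlessExcessT` (generation-17 critic row
  214(a): the law text the depth kernel consumes and the one to register at embargo lift; it implies the landed door law `CleanlessExcess`, K-g1);
  the cut literal `ShallowBearing Y` — MARGIN-UNIFORM Barlow order: at every level `t ∈ (0, 1/200)` the `t`-robustly clean Barlow sites are `R(t)`-dense.
* §B  K-g1 `cleanlessExcess_of_graded`; K-g2 `cleanT_anti` (margin monotonicity of `CleanT`); K-g3/3b `bareOnT_mono` / `bareOnT_subset`;
  **K-g4 `bareOnT_transport`**: a `t₀`-bare ball `B̄(y,R)` recurs as a `(t₀+3ε)`-bare ball `B̄(y',r)` whenever the `(R+2)`-patches at `y, y'` are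
  two-way ε-matched, `r + ε + 2 ≤ R`, `3ε ≤ δ` (contrapositive of the landed `cleanT_transport`); **K-g7 `crossAbsSmall`**: the absolute,
  finite-partner form of the landed `stub_crossTermSmall` — for uniformly discrete `Y` and `η > 0` there is `ℓ₀` with
  `Σ_{y ∈ F_Q} Σ_{w ∈ A} |V(y − w)| ≤ η·ℓ³` for every cube `Q = cube(c,ℓ)`, `ℓ ≥ ℓ₀`, `F_Q = Y ∩ Q` and every finite `A ⊆ Y ∖ F_Q` (slab count
  `card_slab_le` + dyadic tail `sum_abs_lennardJones_le_dyadic`, exactly the landed proof with `|V|`).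
* §P  pins (`Iff.rfl`): `cleanlessExcessT_iff`, `shallowBearing_iff`, `bareOnT_iff` — fully expanded over Mathlib + Literature declarations.

THE GRADED LAW · `CleanlessExcessT` (GS-free, x-free, μGSC-free, recurrence-free, MAT-free, core-free): for every coexistence level `e` (TEND ∧ LB),
separation `δ > 0` and margin level `t₀ ∈ (0, 1/100)` there are `κ(t₀) > 0`, `σ ≥ 0` such that for every `δ`-separated `Y`, centre `c`, radius `R ≥ 1`
and convex `K` with `B̄(c,R/4) ⊆ K ⊆ B̄(c,R)`: `BareOnT t₀ Y K ⟹ (e + κ)·#S − σR² ≤ ½ΣΣ_S V`, `S = Y ∩ K`.  At `κ = σ = 0` TRUE by LB alone.  Physics: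
a `t₀`-bare chunk is Barlow-free (generation-17 cost floor `κ_bare ≈ 2.5e-3`/site) or Barlow with EVERY 12-shell within `t₀` of the window's edge
(elastic floor `≈ c·(a/50 − t₀)²`/site from `V''(1)` over a shell); NOT claimed for `t₀ ≥ a/50` (`margin_le_of_cleanT`).  WHY IT MIGHT FAIL: a family
of `t₀`-bare convex chunks with energy per particle `→ e` at fixed `t₀ < 1/100` (dilute modulations keeping every site marginal; an unknown non-Barlow
packing degenerate with hcp/fcc).  Census ask I-B17 (κ_bare(R; t₀), t₀ ∈ {0, 2e-3, 5e-3, 1e-2}; flags κ_bare(8; 1e-2) ≤ 5e-4 usefulness / ≤ 0 refutes).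
TAGS: XL · IDEA-NEEDED (a quantitative crystallization inequality AWAY from the minimiser set, graded by the robustness margin) · INSTRUMENTABLE ·
PLAUSIBLE-TRUE (critic row 213 for the ungraded law; same estimate plus the elastic branch) · BARRIER-adjacent as the landed law
(`TetrahedralFrustration`, `IcosahedralClusters`, `SutoDegenerateGroundStates` name the competitors it prices; it relocates, does not dissolve, the
frustration core).  Deps (tree only): `Theorems.OverbindingBudgetCleanlessCut` (`BareOn`, `CleanlessExcess`, `margin_le_of_cleanT`),
`…WallTensionLever` (`CleanT`), `…PatchTransport` (`cleanT_transport`), `…CubeTails`, Literature `MuGSC`, `KissingPatterns`.  No `instance`, no `notation`.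
-/

namespace Summit.AtomisticToContinuum.Crystallization.Theorems.OverbindingBudgetGradedBareness

open scoped BigOperators Topology
open Literature.MathematicalPhysics.StatisticalMechanics (UniformlyDiscrete IsMuGSC lennardJones groundStateEnergy)
open Literature.Geometry.DiscreteGeometry (ShellCloseTo fccKissingPattern hcpKissingPattern EtaMatched)
open Summit.AtomisticToContinuum.Crystallization.Theses.OverbindingBudget (RobustDefectLimitWindows CubeChargeLaw)
open Summit.AtomisticToContinuum.Crystallization.Theorems.OverbindingBudgetViolatorDensityFloor (GT)
open Summit.AtomisticToContinuum.Crystallization.Theorems.OverbindingBudgetWallTensionLever (BarlowClose MAT CleanT ThinCores cube_convex closedBall_subset_cube cube_subset_closedBall)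
open Summit.AtomisticToContinuum.Crystallization.Theorems.OverbindingBudgetExcessInstability (finite_inter_cube)
open Summit.AtomisticToContinuum.Crystallization.Theorems.OverbindingBudgetPatchTransport (cleanT_transport)
open Summit.AtomisticToContinuum.Crystallization.Theorems.OverbindingBudgetCubeChargeLaw (cubeChargeLaw stub_crossTermSmall)
open Summit.AtomisticToContinuum.Crystallization.Theorems.OverbindingBudgetCubeBookkeeping (stub_siteSumSplit stub_pairSumLowerBound)
open Summit.AtomisticToContinuum.Crystallization.Theorems.OverbindingBudgetBindingSignLaw (grid_lower_bound)
open Summit.AtomisticToContinuum.Crystallization.Theorems.OverbindingBudgetCubeTails (sum_abs_lennardJones_le_dyadic card_le_of_separated_of_box card_slab_le)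
open Summit.AtomisticToContinuum.Crystallization.Theorems.OverbindingBudgetCleanlessCut (Hosted HostedTarget UnhostedResidual CleanBearing CleanlessPiece CleanBearingResidual BareOn CleanlessExcess margin_le_of_cleanT unhostedResidual_iff_pieces cleanlessPiece_of_cleanlessExcess rdef_iff_three rdef_iff_hosted_unhosted thinCores_of_cleanT_recurrent torn_or_thick_of_unhosted hosted_mono unhostedResidual_of_law_residual cleanT_clean cleanBearingResidual_mono bareOn_of_not_cleanBearing finiteDepth_of_cleanBearing)

/-! ## §A Predicates -/

/-- Graded bareness at margin level `t₀`: no site of `Y` in the body `K` is `t₀`-ROBUSTLY clean Barlow at any admissible spacing (bare = `∀ t₀ > 0`). -/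
def BareOnT (t₀ : ℝ) (Y K : Set (EuclideanSpace ℝ (Fin 3))) : Prop :=
  ∀ y ∈ Y ∩ K, ∀ a : ℝ, 47 / 50 ≤ a → a ≤ 1 → ¬ CleanT a t₀ Y y

/-- **THE GRADED LAW · `CleanlessExcessT`** (same shape as the landed door law `CleanlessExcess`, one more universal `t₀ ∈ (0, 1/100)` before `κ`;
see the module docstring for mechanism, kill criterion and tags).  Implies `CleanlessExcess` (K-g1). -/
def CleanlessExcessT : Prop :=
  ∀ e : ℝ, Filter.Tendsto (fun N : ℕ => Literature.MathematicalPhysics.StatisticalMechanics.groundStateEnergy Literature.MathematicalPhysics.StatisticalMechanics.lennardJones 3 N / N) Filter.atTop (nhds e) → (∀ N : ℕ, 0 < N → e ≤ Literature.MathematicalPhysics.StatisticalMechanics.groundStateEnergy Literature.MathematicalPhysics.StatisticalMechanics.lennardJones 3 N / N) → ∀ δ : ℝ, 0 < δ → ∀ t₀ : ℝ, 0 < t₀ → t₀ < 1 / 100 → ∃ κ : ℝ, 0 < κ ∧ ∃ σ : ℝ, 0 ≤ σ ∧ ∀ Y : Set (EuclideanSpace ℝ (Fin 3)), (∀ p ∈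 Y, ∀ q ∈ Y, p ≠ q → δ ≤ dist p q) → ∀ c : EuclideanSpace ℝ (Fin 3), ∀ R : ℝ, 1 ≤ R → ∀ K : Set (EuclideanSpace ℝ (Fin 3)), Convex ℝ K → Metric.closedBall c (R / 4) ⊆ K → K ⊆ Metric.closedBall c R → BareOnT t₀ Y K → ∀ S : Finset (EuclideanSpace ℝ (Fin 3)), (↑S : Set (EuclideanSpace ℝ (Fin 3))) = Y ∩ K → (e + κ) * (S.card : ℝ) - σ * R ^ 2 ≤ 1 / 2 * ∑ y ∈ S, ∑ w ∈ S, Literature.MathematicalPhysics.StatisticalMechanics.lennardJones (dist y w)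

/-- **THE CUT LITERAL · `ShallowBearing Y`** (MARGIN-UNIFORM Barlow order): for EVERY margin level `t ∈ (0, 1/200)` the `t`-robustly clean Barlow
sites (at admissible spacings) are `R(t)`-DENSE in space — no arbitrarily deep `t`-bare pocket at any level.  Implies `CleanBearing Y` (K-d2). -/
def ShallowBearing (Y : Set (EuclideanSpace ℝ (Fin 3))) : Prop :=
  ∀ t : ℝ, 0 < t → t < 1 / 200 → ∃ R : ℝ, ∀ c : EuclideanSpace ℝ (Fin 3), ∃ y ∈ Y, dist y c ≤ R ∧ ∃ a : ℝ, 47 / 50 ≤ a ∧ a ≤ 1 ∧ CleanT a t Y y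

/-! ## §B Kernels on the graded predicates (no placeholders) -/

/-- Bare ⟹ `t₀`-bare for every `t₀ > 0`. -/
theorem bareOnT_of_bareOn {Y K : Set (EuclideanSpace ℝ (Fin 3))} (h : BareOn Y K) {t₀ : ℝ} (ht : 0 < t₀) : BareOnT t₀ Y K :=
  fun y hy a ha1 ha2 => h y hy a ha1 ha2 t₀ ht

/-- **K-g1.** The graded law implies the landed door law `CleanlessExcess` (take `t₀ := 1/200`); hence (landed K5) it also empties `CleanlessPiece r₀`. -/
theorem cleanlessExcess_of_graded (h : CleanlessExcessT) : CleanlessExcess := by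
  intro e hT hLB δ hδ
  obtain ⟨κ, hκ, σ, hσ, hfl⟩ := h e hT hLB δ hδ (1 / 200) (by norm_num) (by norm_num)
  exact ⟨κ, hκ, σ, hσ, fun Y hsep c R hR K hK h1 h2 hbare S hS =>
    hfl Y hsep c R hR K hK h1 h2 (bareOnT_of_bareOn hbare (by norm_num)) S hS⟩

/-- **K-g2 (margin monotonicity of the robust test).**  A `t`-robustly clean site is `t'`-robustly clean for every `t' ≤ t` with `−a/50 ≤ t'`. -/
theorem cleanT_anti {a t t' : ℝ} {Y : Set (EuclideanSpace ℝ (Fin 3))} {y : EuclideanSpace ℝ (Fin 3)} (ha : 0 < a)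
    (hlo : -(a / 50) ≤ t') (htt : t' ≤ t) (h : CleanT a t Y y) : CleanT a t' Y y := by
  obtain ⟨hcard, hgap, T, hT, hclose⟩ := h
  refine ⟨?_, fun w hw hwy => ?_, T, hT, ?_⟩
  · have hset : {w ∈ Y | w ≠ y ∧ dist y w ≤ a * (1 + 1 / 50) - t'} = {w ∈ Y | w ≠ y ∧ dist y w ≤ a * (1 + 1 / 50) - t} := by
      ext w
      simp only [Set.mem_setOf_eq]
      constructor
      · rintro ⟨hw, hwy, hd⟩
        refine ⟨hw, hwy, ?_⟩
        rcases (hgap w hw hwy).2 with h1 | h1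
        · exact h1
        · exfalso; linarith
      · rintro ⟨hw, hwy, hd⟩
        exact ⟨hw, hwy, by linarith⟩
    rw [hset]; exact hcard
  · obtain ⟨h1, h2⟩ := hgap w hw hwy
    refine ⟨by linarith, ?_⟩
    rcases h2 with h2 | h2
    · left; linarith
    · right; linarith
  · -- shell closeness is monotone in the tolerance (cf. `PalmUnimodularRigidityMinimiserShells.Residual.shellCloseTo_mono`, not imported here)
    rcases hclose with ⟨A, hA⟩ | ⟨A, hA⟩
    · exact Or.inl ⟨A, hA.mono (by linarith)⟩
    · exact Or.inr ⟨A, hA.mono (by linarith)⟩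

/-- **K-g3.** Graded bareness is monotone in the level: `t₀`-bare ⟹ `t₁`-bare for `0 ≤ t₀ ≤ t₁`. -/
theorem bareOnT_mono {t₀ t₁ : ℝ} (ht₀ : 0 ≤ t₀) (h01 : t₀ ≤ t₁) {Y K : Set (EuclideanSpace ℝ (Fin 3))} (h : BareOnT t₀ Y K) :
    BareOnT t₁ Y K := by
  intro y hy a ha1 ha2 hc
  exact h y hy a ha1 ha2 (cleanT_anti (by linarith) (by linarith) h01 hc)

/-- **K-g3b.** Graded bareness is antitone in the body. -/
theorem bareOnT_subset {t₀ : ℝ} {Y K K' : Set (EuclideanSpace ℝ (Fin 3))} (hKK : K' ⊆ K) (h : BareOnT t₀ Y K) : BareOnT t₀ Y K' :=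
  fun y hy => h y ⟨hy.1, hKK hy.2⟩

/-- **K-g4 (APPROXIMATE BARENESS IS TRANSPORTED — the recurrence handle that exact bareness lacks).**  If the `R`-patches of `Y` about the
sites `y, y'` are two-way `ε`-matched and the ball `B̄(y, r)` is `t₀`-bare with `r + 2 ≤ R`, then `B̄(y', r − ε)` is `(t₀ + 3ε)`-bare: a
`(t₀+3ε)`-robust clean site there would transport (landed `cleanT_transport`, margins `t₀ + 3ε ↦ t₀`) to a `t₀`-robust clean site in the bare ball. -/
theorem bareOnT_transport {Y : Set (EuclideanSpace ℝ (Fin 3))} {δ ε R r t₀ : ℝ} {y y' : EuclideanSpace ℝ (Fin 3)}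
    (hsep : ∀ x ∈ Y, ∀ z ∈ Y, x ≠ z → δ ≤ dist x z) (hε0 : 0 ≤ ε) (hεδ : 2 * ε < δ) (hε : 100 * ε ≤ 47 / 50)
    (hex₁ : ∀ p ∈ Y, dist p y ≤ R → ∃ q ∈ Y, dist (p - y) (q - y') ≤ ε)
    (hex₂ : ∀ q ∈ Y, dist q y' ≤ R → ∃ p ∈ Y, dist (p - y) (q - y') ≤ ε)
    (ht₀ : 0 ≤ t₀) (hr : r + 2 ≤ R) (hbare : BareOnT t₀ Y (Metric.closedBall y r)) :
    BareOnT (t₀ + 3 * ε) Y (Metric.closedBall y' (r - ε)) := by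
  intro q hq a ha1 ha2 hc
  obtain ⟨hqY, hqB⟩ := hq
  rw [Metric.mem_closedBall] at hqB
  have ha : 0 < a := by linarith
  have hhi : t₀ + 3 * ε ≤ a / 50 := margin_le_of_cleanT hc
  obtain ⟨p, hpY, hpq⟩ := hex₂ q hqY (by linarith)
  have hpB : p ∈ Metric.closedBall y r := by
    rw [Metric.mem_closedBall]
    have h1 : dist p y = ‖p - y‖ := by rw [dist_eq_norm]
    have h2 : dist q y' = ‖q - y'‖ := by rw [dist_eq_norm]
    have h3 : ‖p - y‖ ≤ ‖q - y'‖ + dist (p - y) (q - y') := by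
      have := norm_le_norm_add_norm_sub' (p - y) (q - y')
      rw [dist_eq_norm]; linarith [norm_sub_rev (p - y) (q - y'), this]
    linarith
  have hT := cleanT_transport (Y := Y) (b₁ := y') (b₂ := y) (y := q) (y' := p) (t := t₀ + 3 * ε) (t' := t₀) hsep hε0 hεδ
    hex₂ hex₁ ha (by linarith) (by linarith) hhi (by linarith) (by nlinarith) hqY hpY hpq (by linarith) (Or.inl ht₀) hc
  exact hbare p ⟨hpY, hpB⟩ a ha1 ha2 hT

/-- **`CrossAbsSmall`**: the absolute, finite-partner form of the landed `stub_crossTermSmall` — the interaction of the sites of a large cube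
with ANY finite family of outside sites is `≤ η·side³` in absolute sum. -/
def CrossAbsSmall : Prop :=
  ∀ Y : Set (EuclideanSpace ℝ (Fin 3)), UniformlyDiscrete Y → ∀ η : ℝ, 0 < η → ∃ ℓ₀ : ℝ, ∀ ℓ : ℝ, ∀ c : EuclideanSpace ℝ (Fin 3), ℓ₀ ≤ ℓ →
    ∀ F : Finset (EuclideanSpace ℝ (Fin 3)), (↑F : Set (EuclideanSpace ℝ (Fin 3))) = Y ∩ {z | ∀ i : Fin 3, c i ≤ z i ∧ z i < c i + ℓ} →
    ∀ A : Finset (EuclideanSpace ℝ (Fin 3)), (↑A : Set (EuclideanSpace ℝ (Fin 3))) ⊆ Y \ ↑F →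
    ∑ y ∈ F, ∑ w ∈ A, |lennardJones (dist y w)| ≤ η * ℓ ^ 3

/-- **K-g7 `crossAbsSmall : CrossAbsSmall`** — the absolute, finite-partner cross bound (proof = the landed `stub_crossTermSmall` argument with
`sum_abs_lennardJones_le_dyadic` in place of `abs_tsum_lennardJones_le_dyadic`; constants identical). -/
theorem crossAbsSmall : CrossAbsSmall := by
  intro Y hUD η hη
  classical
  obtain ⟨δ, hδ, hsep⟩ := id hUD
  -- constants
  set G : ℝ := 432 * (δ⁻¹ ^ 6 + 1) * δ⁻¹ ^ 3 with hG
  have hG0 : 0 ≤ G := by positivity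
  set B : ℝ := G * δ⁻¹ ^ 3 with hB
  have hB0 : 0 ≤ B := by positivity
  set R : ℝ := max (max 1 δ) (54 * G * δ⁻¹ ^ 3 / η) with hR
  have hR1 : max 1 δ ≤ R := le_max_left _ _
  have hR1' : 1 ≤ R := (le_max_left _ _).trans hR1
  have hRδ : δ ≤ R := (le_max_right _ _).trans hR1
  have hR0 : 0 < R := by linarith
  have hRη : 54 * G * δ⁻¹ ^ 3 / η ≤ R := le_max_right _ _
  refine ⟨max (max 1 δ) (324 * R * δ⁻¹ ^ 3 * B / η), fun ℓ c hℓ F hF A hA => ?_⟩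
  have hℓ1 : 1 ≤ ℓ := ((le_max_left _ _).trans (le_max_left _ _)).trans hℓ
  have hℓδ : δ ≤ ℓ := ((le_max_right _ _).trans (le_max_left _ _)).trans hℓ
  have hℓ0 : 0 < ℓ := by linarith
  have hℓB : 324 * R * δ⁻¹ ^ 3 * B / η ≤ ℓ := (le_max_right _ _).trans hℓ
  -- membership facts
  have hFY : (↑F : Set (EuclideanSpace ℝ (Fin 3))) ⊆ Y := by
    rw [hF]; exact Set.inter_subset_left
  have hFcube : ∀ z ∈ F, ∀ i, c i ≤ z i ∧ z i < c i + ℓ := by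
    intro z hz
    have hz' : z ∈ (↑F : Set (EuclideanSpace ℝ (Fin 3))) := Finset.mem_coe.2 hz
    rw [hF] at hz'
    exact hz'.2
  have hout : ∀ w ∈ Y \ (↑F : Set (EuclideanSpace ℝ (Fin 3))), ∃ i, w i < c i ∨ c i + ℓ ≤ w i := by
    intro w hw
    by_contra h
    push Not at h
    have hw' : w ∈ (↑F : Set (EuclideanSpace ℝ (Fin 3))) := by
      rw [hF]; exact ⟨hw.1, h⟩
    exact hw.2 hw'
  have hTsep : ∀ z ∈ Y \ (↑F : Set (EuclideanSpace ℝ (Fin 3))), ∀ w ∈ Y \ (↑F : Set (EuclideanSpace ℝ (Fin 3))), z ≠ w → δ ≤ dist z w :=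
    fun z hz w hw hzw => hsep z hz.1 w hw.1 hzw
  -- the site tails
  set T : EuclideanSpace ℝ (Fin 3) → ℝ := fun y => ∑ w ∈ A, |lennardJones (dist y w)| with hT
  have hAY : ∀ z ∈ A, z ∈ Y \ (↑F : Set (EuclideanSpace ℝ (Fin 3))) := fun z hz => hA (Finset.mem_coe.2 hz)
  have hAsep : ∀ z ∈ A, ∀ w ∈ A, z ≠ w → δ ≤ dist z w := fun z hz w hw hzw => hsep z (hAY z hz).1 w (hAY w hw).1 hzw
  have hTabs : ∀ y, |T y| = T y := fun y => abs_of_nonneg (Finset.sum_nonneg (fun w _ => abs_nonneg _))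
  have hcrude : ∀ y ∈ F, |T y| ≤ B := by
    intro y hy
    have hyY : y ∈ Y := hFY (Finset.mem_coe.2 hy)
    rw [hTabs]
    have h := sum_abs_lennardJones_le_dyadic A y hδ le_rfl
      (fun z hz => hsep y hyY z (hAY z hz).1 (fun hyz => (hAY z hz).2 (hyz ▸ (Finset.mem_coe.2 hy)))) hAsep
    simpa only [hB, hG] using h
  have hfar : ∀ y ∈ F, (∀ i, c i + R ≤ y i ∧ y i < c i + ℓ - R) → |T y| ≤ G * R⁻¹ ^ 3 := by
    intro y hy hint
    rw [hTabs]
    have h := sum_abs_lennardJones_le_dyadic A y hδ hRδ (fun w hw => ?far) hAsep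
    · simpa only [hG] using h
    case far =>
      obtain ⟨i, hi⟩ := hout w (hAY w hw)
      have hci := hint i
      have hcoord : R ≤ |y i - w i| := by
        rcases hi with h | h
        · rw [abs_of_nonneg (by linarith [hci.1])]
          linarith [hci.1]
        · rw [abs_of_nonpos (by linarith [hci.2])]
          linarith [hci.2]
      exact hcoord.trans (le_of_eq_of_le (Real.dist_eq (y i) (w i)).symm (PiLp.dist_apply_le y w i))
  -- splitting the sites into deep and shallow ones
  set P : EuclideanSpace ℝ (Fin 3) → Prop := fun y => ∀ i, c i + R ≤ y i ∧ y i < c i + ℓ - R with hP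
  have hsum : ∑ y ∈ F, |T y| =
      ∑ y ∈ F.filter P, |T y| + ∑ y ∈ F.filter (fun y => ¬ P y), |T y| :=
    (Finset.sum_filter_add_sum_filter_not F P _).symm
  have hint : ∑ y ∈ F.filter P, |T y| ≤ (F.filter P).card * (G * R⁻¹ ^ 3) := by
    have h := Finset.sum_le_sum (fun y hy => hfar y (Finset.mem_filter.1 hy).1 (Finset.mem_filter.1 hy).2)
    rwa [Finset.sum_const, nsmul_eq_mul] at h
  have hlay : ∑ y ∈ F.filter (fun y => ¬ P y), |T y| ≤ (F.filter (fun y => ¬ P y)).card * B := by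
    have h : ∑ y ∈ F.filter (fun y => ¬ P y), |T y| ≤ ∑ _y ∈ F.filter (fun y => ¬ P y), B :=
      Finset.sum_le_sum (fun y hy => hcrude y (Finset.mem_filter.1 hy).1)
    rwa [Finset.sum_const, nsmul_eq_mul] at h
  -- counting: all sites
  have hcardP : ((F.filter P).card : ℝ) ≤ F.card := by exact_mod_cast Finset.card_filter_le _ _
  have hFle : (F.card : ℝ) ≤ (2 * ℓ / δ + 1) ^ 3 := by
    have h := card_le_of_separated_of_box F (fun i => c i) (fun _ => ℓ) hδ (fun _ => hℓ0.le)
      (fun z hz i => hFcube z hz i)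
      (fun z hz w hw hzw => hsep z (hFY (Finset.mem_coe.2 hz)) w (hFY (Finset.mem_coe.2 hw)) hzw)
    simpa [Finset.prod_const, Finset.card_univ, Fintype.card_fin] using h
  -- counting: shallow sites lie in six slabs
  set Sm : Fin 3 → Finset (EuclideanSpace ℝ (Fin 3)) := fun i => F.filter (fun z => z i < c i + R) with hSm
  set Sp : Fin 3 → Finset (EuclideanSpace ℝ (Fin 3)) := fun i => F.filter (fun z => c i + ℓ - R ≤ z i) with hSp
  have hsub : F.filter (fun y => ¬ P y) ⊆ Finset.univ.biUnion (fun i => Sm i ∪ Sp i) := by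
    intro z hz
    rw [Finset.mem_filter] at hz
    obtain ⟨hzF, hnP⟩ := hz
    have hnP' : ∃ i, z i < c i + R ∨ c i + ℓ - R ≤ z i := by
      by_contra h
      push Not at h
      exact hnP h
    obtain ⟨i, hi⟩ := hnP'
    rw [Finset.mem_biUnion]
    refine ⟨i, Finset.mem_univ _, ?_⟩
    rw [Finset.mem_union]
    rcases hi with h | h
    · left
      exact Finset.mem_filter.2 ⟨hzF, h⟩
    · right
      exact Finset.mem_filter.2 ⟨hzF, h⟩
  have hSm_le : ∀ i, ((Sm i).card : ℝ) ≤ (2 * R / δ + 1) * (2 * ℓ / δ + 1) ^ 2 := by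
    intro i
    exact card_slab_le (Sm i) c ℓ R (c i) i hδ hℓ0.le hR0.le
      (fun z hz j => hFcube z (Finset.mem_filter.1 hz).1 j)
      (fun z hz => ⟨(hFcube z (Finset.mem_filter.1 hz).1 i).1, (Finset.mem_filter.1 hz).2⟩)
      (fun z hz w hw hzw => hsep z (hFY (Finset.mem_coe.2 (Finset.mem_filter.1 hz).1)) w
        (hFY (Finset.mem_coe.2 (Finset.mem_filter.1 hw).1)) hzw)
  have hSp_le : ∀ i, ((Sp i).card : ℝ) ≤ (2 * R / δ + 1) * (2 * ℓ / δ + 1) ^ 2 := by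
    intro i
    exact card_slab_le (Sp i) c ℓ R (c i + ℓ - R) i hδ hℓ0.le hR0.le
      (fun z hz j => hFcube z (Finset.mem_filter.1 hz).1 j)
      (fun z hz => ⟨(Finset.mem_filter.1 hz).2, by
        have := (hFcube z (Finset.mem_filter.1 hz).1 i).2; linarith⟩)
      (fun z hz w hw hzw => hsep z (hFY (Finset.mem_coe.2 (Finset.mem_filter.1 hz).1)) w
        (hFY (Finset.mem_coe.2 (Finset.mem_filter.1 hw).1)) hzw)
  have hlayer : ((F.filter (fun y => ¬ P y)).card : ℝ) ≤ 6 * ((2 * R / δ + 1) * (2 * ℓ / δ + 1) ^ 2) := by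
    calc ((F.filter (fun y => ¬ P y)).card : ℝ)
        ≤ ((Finset.univ.biUnion (fun i => Sm i ∪ Sp i)).card : ℝ) := by
          exact_mod_cast Finset.card_le_card hsub
      _ ≤ ∑ i, ((Sm i ∪ Sp i).card : ℝ) := by
          exact_mod_cast Finset.card_biUnion_le
      _ ≤ ∑ i, (((Sm i).card : ℝ) + (Sp i).card) :=
          Finset.sum_le_sum (fun i _ => by exact_mod_cast Finset.card_union_le _ _)
      _ ≤ ∑ _i : Fin 3, 2 * ((2 * R / δ + 1) * (2 * ℓ / δ + 1) ^ 2) :=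
          Finset.sum_le_sum (fun i _ => by linarith [hSm_le i, hSp_le i])
      _ = 6 * ((2 * R / δ + 1) * (2 * ℓ / δ + 1) ^ 2) := by
          simp only [Finset.sum_const, Finset.card_univ, Fintype.card_fin, nsmul_eq_mul]
          push_cast
          ring
  -- arithmetic
  have hu0 : 0 < δ⁻¹ := inv_pos.2 hδ
  have hv0 : 0 < R⁻¹ := inv_pos.2 hR0
  have hv1 : R⁻¹ ≤ 1 := inv_le_one_of_one_le₀ hR1'
  have hℓu : 1 ≤ ℓ * δ⁻¹ := by
    rw [← div_eq_mul_inv, le_div_iff₀ hδ]; linarith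
  have hRu : 1 ≤ R * δ⁻¹ := by
    rw [← div_eq_mul_inv, le_div_iff₀ hδ]; linarith
  have hA0 : 0 ≤ G * R⁻¹ ^ 3 := by positivity
  -- (2ℓ/δ + 1)³ ≤ 27 ℓ³ δ⁻³ and the slab bound ≤ 27 R ℓ² δ⁻³
  have h2ℓ : 2 * ℓ / δ + 1 ≤ 3 * (ℓ * δ⁻¹) := by rw [div_eq_mul_inv]; linarith
  have h2R : 2 * R / δ + 1 ≤ 3 * (R * δ⁻¹) := by rw [div_eq_mul_inv]; linarith
  have h2ℓ0 : 0 ≤ 2 * ℓ / δ + 1 := by positivity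
  have h2R0 : 0 ≤ 2 * R / δ + 1 := by positivity
  have hcube3 : (2 * ℓ / δ + 1) ^ 3 ≤ (3 * (ℓ * δ⁻¹)) ^ 3 := pow_le_pow_left₀ h2ℓ0 h2ℓ 3
  have hslab3 : (2 * R / δ + 1) * (2 * ℓ / δ + 1) ^ 2 ≤ (3 * (R * δ⁻¹)) * (3 * (ℓ * δ⁻¹)) ^ 2 :=
    mul_le_mul h2R (pow_le_pow_left₀ h2ℓ0 h2ℓ 2) (by positivity) (by positivity)
  -- first half: deep sites
  have hkey1 : 54 * G * δ⁻¹ ^ 3 * R⁻¹ ≤ η := by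
    have h := hRη
    rw [div_le_iff₀ hη] at h
    have hR' : R ≠ 0 := hR0.ne'
    calc 54 * G * δ⁻¹ ^ 3 * R⁻¹ ≤ R * η * R⁻¹ := by gcongr
      _ = η := by field_simp
  have hv3 : R⁻¹ ^ 3 ≤ R⁻¹ := pow_le_of_le_one hv0.le hv1 (by norm_num)
  have hdeep : (F.card : ℝ) * (G * R⁻¹ ^ 3) ≤ η / 2 * ℓ ^ 3 := by
    calc (F.card : ℝ) * (G * R⁻¹ ^ 3)
        ≤ (3 * (ℓ * δ⁻¹)) ^ 3 * (G * R⁻¹ ^ 3) :=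
          mul_le_mul_of_nonneg_right (hFle.trans hcube3) hA0
      _ = ℓ ^ 3 * (27 * G * δ⁻¹ ^ 3 * R⁻¹ ^ 3) := by ring
      _ ≤ ℓ ^ 3 * (27 * G * δ⁻¹ ^ 3 * R⁻¹) := by
          apply mul_le_mul_of_nonneg_left _ (by positivity)
          exact mul_le_mul_of_nonneg_left hv3 (by positivity)
      _ ≤ ℓ ^ 3 * (η / 2) := by
          apply mul_le_mul_of_nonneg_left _ (by positivity)
          linarith
      _ = η / 2 * ℓ ^ 3 := by ring
  -- second half: shallow sites
  have hkey2 : 324 * R * δ⁻¹ ^ 3 * B ≤ ℓ * η := by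
    have h := hℓB
    rwa [div_le_iff₀ hη] at h
  have hshallow : ((F.filter (fun y => ¬ P y)).card : ℝ) * B ≤ η / 2 * ℓ ^ 3 := by
    calc ((F.filter (fun y => ¬ P y)).card : ℝ) * B
        ≤ 6 * ((3 * (R * δ⁻¹)) * (3 * (ℓ * δ⁻¹)) ^ 2) * B := by
          apply mul_le_mul_of_nonneg_right _ hB0
          exact hlayer.trans (by linarith [hslab3])
      _ = ℓ ^ 2 * (324 * R * δ⁻¹ ^ 3 * B) / 2 := by ring
      _ ≤ ℓ ^ 2 * (ℓ * η) / 2 := by gcongr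
      _ = η / 2 * ℓ ^ 3 := by ring
  -- conclusion
  have hTT : ∑ y ∈ F, T y = ∑ y ∈ F, |T y| := Finset.sum_congr rfl (fun y _ => (hTabs y).symm)
  show ∑ y ∈ F, T y ≤ η * ℓ ^ 3
  calc ∑ y ∈ F, T y = ∑ y ∈ F, |T y| := hTT
    _ = ∑ y ∈ F.filter P, |T y| + ∑ y ∈ F.filter (fun y => ¬ P y), |T y| := hsum
    _ ≤ (F.filter P).card * (G * R⁻¹ ^ 3) + (F.filter (fun y => ¬ P y)).card * B :=
        add_le_add hint hlay
    _ ≤ (F.card : ℝ) * (G * R⁻¹ ^ 3) + (F.filter (fun y => ¬ P y)).card * B := by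
        gcongr
    _ ≤ η / 2 * ℓ ^ 3 + η / 2 * ℓ ^ 3 := add_le_add hdeep hshallow
    _ = η * ℓ ^ 3 := by ring

/-! ## §P Pins (`Iff.rfl`) — the readable predicates ARE the lineage texts -/

/-- PIN · the graded law, fully expanded over Mathlib + Literature declarations (the text a later bundle registers as `stub_cleanlessExcessT`;
it implies the generation-17 door-law text `cleanlessExcess_iff` by `cleanlessExcess_of_graded`). -/
theorem cleanlessExcessT_iff : CleanlessExcessT ↔ (∀ e : ℝ, Filter.Tendsto (fun N : ℕ => Literature.MathematicalPhysics.StatisticalMechanics.groundStateEnergy Literature.MathematicalPhysics.StatisticalMechanics.lennardJones 3 N / N) Filter.atTop (nhds e) → (∀ N : ℕ, 0 < N → e ≤ Literature.MathematicalPhysics.StatisticalMechanics.groundStateEnergy Literature.MathematicalPhysics.StatisticalMechanics.lennardJones 3 N / N) → ∀ δ : ℝ, 0 < δ → ∀ t₀ : ℝ, 0 < t₀ → t₀ < 1 / 100 → ∃ κ : ℝ, 0 < κ ∧ ∃ σ : ℝ, 0 ≤ σ ∧ ∀ Y : Set (EuclideanSpace ℝ (Fin 3)), (∀ p ∈ Y,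 ∀ q ∈ Y, p ≠ q → δ ≤ dist p q) → ∀ c : EuclideanSpace ℝ (Fin 3), ∀ R : ℝ, 1 ≤ R → ∀ K : Set (EuclideanSpace ℝ (Fin 3)), Convex ℝ K → Metric.closedBall c (R / 4) ⊆ K → K ⊆ Metric.closedBall c R → (∀ y ∈ Y ∩ K, ∀ a : ℝ, 47 / 50 ≤ a → a ≤ 1 → ¬ ({w ∈ Y | w ≠ y ∧ dist y w ≤ a * (1 + 1 / 50) - t₀}.ncard = 12 ∧ (∀ w ∈ Y, w ≠ y → a * (1 - 1 / 50) + t₀ ≤ dist y w ∧ (dist y w ≤ a * (1 + 1 / 50) - t₀ ∨ a * (63 / 50) + t₀ ≤ dist y w)) ∧ (∃ T : Finset (EuclideanSpace ℝ (Fin 3)), (↑T : Set (EuclideanSpace ℝ (Fin 3))) = (fun w => a⁻¹ • (w - y)) '' {w ∈ Y | w ≠ y ∧ dist y w ≤ a * (1 + 1 / 50)} ∧ (Literature.Geometry.DiscreteGeometry.ShellCloseTo (1 / 5 - t₀) T Literature.Geometry.DiscreteGeometry.fccKissingPattern ∨ Literature.Geometry.DiscreteGeometry.ShellCloseTo (1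 / 5 - t₀) T Literature.Geometry.DiscreteGeometry.hcpKissingPattern)))) → ∀ S : Finset (EuclideanSpace ℝ (Fin 3)), (↑S : Set (EuclideanSpace ℝ (Fin 3))) = Y ∩ K → (e + κ) * (S.card : ℝ) - σ * R ^ 2 ≤ 1 / 2 * ∑ y ∈ S, ∑ w ∈ S, Literature.MathematicalPhysics.StatisticalMechanics.lennardJones (dist y w)) :=
  Iff.rfl

/-- PIN · the cut literal, fully expanded. -/
theorem shallowBearing_iff (Y : Set (EuclideanSpace ℝ (Fin 3))) : ShallowBearing Y ↔ (∀ t : ℝ, 0 < t → t < 1 / 200 → ∃ R : ℝ, ∀ c : EuclideanSpace ℝ (Fin 3), ∃ y ∈ Y, dist y c ≤ R ∧ ∃ a : ℝ, 47 / 50 ≤ a ∧ a ≤ 1 ∧ ({w ∈ Y | w ≠ y ∧ dist y w ≤ a * (1 + 1 / 50) - t}.ncard = 12 ∧ (∀ w ∈ Y, w ≠ y → a * (1 - 1 / 50) + t ≤ dist y w ∧ (dist y w ≤ a * (1 + 1 / 50) - t ∨ a * (63 / 50) + t ≤ dist y w)) ∧ (∃ T : Finset (EuclideanSpace ℝ (Fin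 3)), (↑T : Set (EuclideanSpace ℝ (Fin 3))) = (fun w => a⁻¹ • (w - y)) '' {w ∈ Y | w ≠ y ∧ dist y w ≤ a * (1 + 1 / 50)} ∧ (Literature.Geometry.DiscreteGeometry.ShellCloseTo (1 / 5 - t) T Literature.Geometry.DiscreteGeometry.fccKissingPattern ∨ Literature.Geometry.DiscreteGeometry.ShellCloseTo (1 / 5 - t) T Literature.Geometry.DiscreteGeometry.hcpKissingPattern)))) :=
  Iff.rfl

/-- PIN · graded bareness, fully expanded. -/
theorem bareOnT_iff (t₀ : ℝ) (Y K : Set (EuclideanSpace ℝ (Fin 3))) : BareOnT t₀ Y K ↔ (∀ y ∈ Y ∩ K, ∀ a : ℝ, 47 / 50 ≤ a → a ≤ 1 → ¬ ({w ∈ Y | w ≠ y ∧ dist y w ≤ a * (1 + 1 / 50) - t₀}.ncard = 12 ∧ (∀ w ∈ Y, w ≠ y → a * (1 - 1 / 50) + t₀ ≤ dist y w ∧ (dist y w ≤ a * (1 + 1 / 50) - t₀ ∨ a * (63 / 50) + t₀ ≤ dist y w)) ∧ (∃ T : Finset (EuclideanSpace ℝ (Fin 3)), (↑T : Set (EuclideanSpace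 ℝ (Fin 3))) = (fun w => a⁻¹ • (w - y)) '' {w ∈ Y | w ≠ y ∧ dist y w ≤ a * (1 + 1 / 50)} ∧ (Literature.Geometry.DiscreteGeometry.ShellCloseTo (1 / 5 - t₀) T Literature.Geometry.DiscreteGeometry.fccKissingPattern ∨ Literature.Geometry.DiscreteGeometry.ShellCloseTo (1 / 5 - t₀) T Literature.Geometry.DiscreteGeometry.hcpKissingPattern)))) :=
  Iff.rfl

end Summit.AtomisticToContinuum.Crystallization.Theorems.OverbindingBudgetGradedBareness
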